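import Mathlib
import Summits.Ventures.PercRepro2.MixChordLawExists
import Summits.Ventures.PercRepro2.ParallelEdgeClasses

/-!
# The crux from the WEAKEST `o`-class chord rows (blind cell PercRepro2, night-1 g21;
proofs/NIGHT1-G21.md §1, §9)

The `o`-class `D`-law of record (`DLawO_all`, the census-exact object) is the STRONGEST statement of
the normaliser family; the induction needs only a chord that is an inductive step
(`Gc_nonneg_of_nMixChord_D` / `_DZ` / `_DZ2`).  Here the `o`-class obligation is stated as a CHORD
row with each of the three normalisers — `DChordO_all` (ParallelEdgeClasses.lean), **`DZChordO_all`**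
(the penalty-free rows `R₀`, `R₁` of NIGHT1-G21.md §1) and **`DZ2ChordO_all`** (the `(D·Z)²`-chord,
the weakest, with the bonus `(1 − π)(1 − λ)Γ⁰`) — and the crux follows from any of them together with
the existential (MIX²) row off the `o`-class (`MixChord2ExistsNoO_all`):
**`HCov_all_of_dChordO_of_exists`**, **`HCov_all_of_dzChordO_of_exists`**,
**`HCov_all_of_dz2ChordO_of_exists`**.  By the doubling lemma the `D`-chord row is the `D`-law row
(`DLawO_all_iff_DChordO_all`), so `HCov_all_of_dChordO_of_exists` is g20's
`HCov_all_of_dLawO_of_exists` restated on the chord side.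

Own code; standard axioms.
-/

namespace Summit.Ventures.PercRepro2

open UnionCluster CovForm

namespace Mix

open scoped Classical

section Step

variable {V : Type*} {E : Type*} [Fintype E] [DecidableEq E] {R : Type*} [Field R]
  [LinearOrder R] [IsStrictOrderedRing R]

/-- **The inductive step at `p`** from a chord along the `o`-class root edges whose normaliser is an
inductive step (`hstep`: the chord at `e` gives `Gc ≥ 0` from the children's), and, when `p` has no
`o`-class root edge, some root edge satisfying (MIX²). -/
theorem step_of_chordO_of_exists {p : E → R} {ends : E → Sym2 V} {o a₁ a₂ a₃ b : V}
    (hp : IsProbVec p) (N : (E → R) → R)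
    (hstep : ∀ e ∈ Chord.rootEdges p ends a₁ a₂, NMixChord N p ends o a₁ a₂ a₃ b e →
      0 ≤ Gc (Function.update p e 1) ends o a₁ a₂ a₃ b →
      0 ≤ Gc (Function.update p e 0) ends o a₁ a₂ a₃ b → 0 ≤ Gc p ends o a₁ a₂ a₃ b)
    (hO : ∀ e ∈ Chord.rootEdges p ends a₁ a₂, OClass p ends o a₁ a₂ e →
      NMixChord N p ends o a₁ a₂ a₃ b e)
    (hE : (∀ e ∈ Chord.rootEdges p ends a₁ a₂, ¬ OClass p ends o a₁ a₂ e) →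
      (Chord.rootEdges p ends a₁ a₂).Nonempty → ∃ e ∈ Chord.rootEdges p ends a₁ a₂,
        p e * Gc (Function.update p e 1) ends o a₁ a₂ a₃ b +
          (1 - p e) * (shrink p ends a₁ a₂ a₃ e ^ 2 * Gc (Function.update p e 0) ends o a₁ a₂ a₃ b) ≤
            Gc p ends o a₁ a₂ a₃ b) :
    InductiveStep p ends o a₁ a₂ a₃ b := by
  intro hne
  by_cases hO' : ∃ e ∈ Chord.rootEdges p ends a₁ a₂, OClass p ends o a₁ a₂ e
  · obtain ⟨e, he, hc⟩ := hO'
    exact ⟨e, he, fun h1 h0 => hstep e he (hO e he hc) h1 h0⟩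
  · have hno : ∀ e ∈ Chord.rootEdges p ends a₁ a₂, ¬ OClass p ends o a₁ a₂ e :=
      fun e he hc => hO' ⟨e, he, hc⟩
    obtain ⟨e, he, hle⟩ := hE hno hne
    refine ⟨e, he, fun h1 h0 => ?_⟩
    exact (add_nonneg (mul_nonneg (hp.nonneg e) h1)
      (mul_nonneg (sub_nonneg.2 (hp.le_one e))
        (mul_nonneg (pow_nonneg (shrink_nonneg hp ends a₁ a₂ a₃ e) 2) h0))).trans hle

end Step

section Rows

variable (R : Type*) [Field R] [LinearOrder R] [IsStrictOrderedRing R]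

/-- **Row (CHORD-DZ-o)**: the penalty-free `D·Z`-chord along every root edge of the `o`-class, on
all instances (the rows `R₀`, `R₁` of NIGHT1-G21.md §1). -/
def DZChordO_all : Prop :=
  ∀ (V E : Type) [Fintype V] [DecidableEq V] [Fintype E] [DecidableEq E]
    (ends : E → Sym2 V) (p : E → R), IsProbVec p →
    ∀ o a₁ a₂ a₃ b : V, a₁ ≠ a₂ → a₁ ≠ a₃ → a₂ ≠ a₃ → o ≠ a₁ → o ≠ a₂ → o ≠ a₃ → o ≠ b →
      b ≠ a₁ → b ≠ a₂ → b ≠ a₃ →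
      ∀ e ∈ Chord.rootEdges p ends a₁ a₂, OClass p ends o a₁ a₂ e →
        NMixChord (normDZ ends a₁ a₂ a₃) p ends o a₁ a₂ a₃ b e

/-- **Row (CHORD-DZ²-o)**: the `(D·Z)²`-chord (the weakest of the family) along every root edge of
the `o`-class, on all instances. -/
def DZ2ChordO_all : Prop :=
  ∀ (V E : Type) [Fintype V] [DecidableEq V] [Fintype E] [DecidableEq E]
    (ends : E → Sym2 V) (p : E → R), IsProbVec p →
    ∀ o a₁ a₂ a₃ b : V, a₁ ≠ a₂ → a₁ ≠ a₃ → a₂ ≠ a₃ → o ≠ a₁ → o ≠ a₂ → o ≠ a₃ → o ≠ b →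
      b ≠ a₁ → b ≠ a₂ → b ≠ a₃ →
      ∀ e ∈ Chord.rootEdges p ends a₁ a₂, OClass p ends o a₁ a₂ e →
        NMixChord (normDZ2 ends a₁ a₂ a₃) p ends o a₁ a₂ a₃ b e

/-- **The crux from the `o`-class `D`-chord row and the existential (MIX²) row.** -/
theorem HCov_all_of_dChordO_of_exists (h₁ : ParallelEdge.DChordO_all R)
    (h₂ : MixChord2ExistsNoO_all R) : HCov_all R :=
  HCov_all_of_inductiveStep_all R fun V E _ _ _ _ ends p hp o a₁ a₂ a₃ b h12 h13 h23 ho1 ho2 ho3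
    hob hb1 hb2 hb3 =>
      step_of_chordO_of_exists hp _ (fun _ _ hc h1 h0 => Gc_nonneg_of_nMixChord_D hp hc h1 h0)
        (h₁ V E ends p hp o a₁ a₂ a₃ b h12 h13 h23 ho1 ho2 ho3 hob hb1 hb2 hb3)
        (h₂ V E ends p hp o a₁ a₂ a₃ b h12 h13 h23 ho1 ho2 ho3 hob hb1 hb2 hb3)

/-- **The crux from the penalty-free `o`-class `D·Z`-chord row and the existential (MIX²) row.** -/
theorem HCov_all_of_dzChordO_of_exists (h₁ : DZChordO_all R) (h₂ : MixChord2ExistsNoO_all R) :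
    HCov_all R :=
  HCov_all_of_inductiveStep_all R fun V E _ _ _ _ ends p hp o a₁ a₂ a₃ b h12 h13 h23 ho1 ho2 ho3
    hob hb1 hb2 hb3 =>
      step_of_chordO_of_exists hp _ (fun _ _ hc h1 h0 => Gc_nonneg_of_nMixChord_DZ hp hc h1 h0)
        (h₁ V E ends p hp o a₁ a₂ a₃ b h12 h13 h23 ho1 ho2 ho3 hob hb1 hb2 hb3)
        (h₂ V E ends p hp o a₁ a₂ a₃ b h12 h13 h23 ho1 ho2 ho3 hob hb1 hb2 hb3)

/-- **The crux from the weakest `o`-class row — the `(D·Z)²`-chord — and the existential (MIX²)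
row.** -/
theorem HCov_all_of_dz2ChordO_of_exists (h₁ : DZ2ChordO_all R) (h₂ : MixChord2ExistsNoO_all R) :
    HCov_all R :=
  HCov_all_of_inductiveStep_all R fun V E _ _ _ _ ends p hp o a₁ a₂ a₃ b h12 h13 h23 ho1 ho2 ho3
    hob hb1 hb2 hb3 =>
      step_of_chordO_of_exists hp _ (fun _ _ hc h1 h0 => Gc_nonneg_of_nMixChord_DZ2 hp hc h1 h0)
        (h₁ V E ends p hp o a₁ a₂ a₃ b h12 h13 h23 ho1 ho2 ho3 hob hb1 hb2 hb3)
        (h₂ V E ends p hp o a₁ a₂ a₃ b h12 h13 h23 ho1 ho2 ho3 hob hb1 hb2 hb3)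

/-- g20's chain restated on the chord side: the `D`-law row is the `D`-chord row. -/
theorem HCov_all_of_dLawO_of_exists' (h₁ : DLawO_all R) (h₂ : MixChord2ExistsNoO_all R) :
    HCov_all R :=
  HCov_all_of_dChordO_of_exists R ((ParallelEdge.DLawO_all_iff_DChordO_all R).1 h₁) h₂

end Rows

end Mix

end Summit.Ventures.PercRepro2
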